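import Literature.NumberTheory.NumberFields.AmbiguousClassNumberNarrowInequality
import Literature.NumberTheory.EllipticCurves.ZpExtension
import HarnessLib

set_option autoImplicit false

/-!
# The narrow `2`-defect IS the unit-signature defect: `ord₂ h⁺(K) − ord₂ h(K) = r₁(K) − log₂ #sign(E_K)`, layer by layer up a `ℤ₂`-tower

Topic `NumberTheory/IwasawaTheory` (namespace = path).  THEOREM-ONLY file (no definition, no named fact, no `sorry`), written by the prover seat
`bsd-line-att-p4` g33 (cell `bsd-f1-sign2`, `--supports` stmt-BirchSwinnertonDyer-22298; closes nothing; BSD is proved for no curve here).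

WHY. The cell's named input for crux C2 on totally real cubic fields carries the clause «the narrow `2`-defect `ord₂ h⁺(F_n) − ord₂ h(F_n)` is bounded
along the cyclotomic `ℤ₂`-tower» (Kida's `μ₂*`, `Summits/…/AlignedTransportAtTwoMainConjectureOfRankZeroBSDAtTwoNarrowCubicNamedInput`). REF2 g70 asked
that it be readable as «units of independent signs up to bounded index». Fröhlich–Taylor's `h⁺ · #sign(E) = h · 2^{r₁}` (tree
`narrowClassNumber_mul_card_unitSignatures`, valuation form `AmbiguousClass.padicValNat_narrowClassNumber_add_card_unitSignatures`) makes the two the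
SAME number at every layer:

* `padicValNat_two_narrowClassNumber_add_eq` — `ord₂ h⁺(K) + ord₂ #sign(E_K) = ord₂ h(K) + r₁(K)` (`r₁ = nrRealPlaces`);
* `narrowDefect_le_iff_signatureDefect_le` — `ord₂ h⁺(K) ≤ ord₂ h(K) + D ⟺ r₁(K) ≤ ord₂ #sign(E_K) + D`;
* ★ `exists_narrowDefect_le_iff_exists_signatureDefect_le` — for the layers of ANY `ℤ₂`-extension `κ` of a number field: «`∃ D ∀ n, ord₂ h⁺(K_n) ≤
  ord₂ h(K_n) + D`» ⟺ «`∃ D ∀ n, r₁(K_n) ≤ ord₂ #sign(E_{K_n}) + D`» — THE SIGNED OBJECT: the units of `K_n` realise all but boundedly many of the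
  `r₁(K_n)` sign patterns; and the `∀ κ` (cyclotomic) form used by the cell, `forall_exists_…`.

References: [FrohlichTaylor1990] Ch. V §1 (1.12), p. 164; [Kida1982JFields] Thm. 1, Remark (ii); [Washington1997] §13.3; tree: `NumberFields/NarrowClassGroup`,
`NumberFields/AmbiguousClassNumberNarrowInequality`.
-/

noncomputable section

open scoped NumberField
open NumberField NumberField.InfinitePlace

namespace Literature.NumberTheory.IwasawaTheory

open Literature.NumberTheory.EllipticCurves Literature.NumberTheory.NumberFields

/-- **`ord₂ h⁺(K) + ord₂ #sign(E_K) = ord₂ h(K) + r₁(K)`** (Fröhlich–Taylor (1.12) on `2`-adic valuations; `#sign(E_K) = [E_K : E_K⁺]` is a power of `2`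
dividing `2^{r₁}`). [cite: FrohlichTaylor1990, Ch. V §1 (1.12), p. 164] -/
theorem padicValNat_two_narrowClassNumber_add_eq (K : Type) [Field K] [NumberField K] :
    padicValNat 2 (narrowClassNumber K) + padicValNat 2 (Nat.card ((unitsRange K).map (signHom K))) =
      padicValNat 2 (classNumber K) + nrRealPlaces K := by
  haveI : Fact (Nat.Prime 2) := ⟨Nat.prime_two⟩
  have h := AmbiguousClass.padicValNat_narrowClassNumber_add_card_unitSignatures (K := K) 2
  rwa [padicValNat.prime_pow] at h

/-- **Narrow defect ≤ D ⟺ unit-signature defect ≤ D**, one field: `ord₂ h⁺(K) ≤ ord₂ h(K) + D ⟺ r₁(K) ≤ ord₂ #sign(E_K) + D`.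
[cite: FrohlichTaylor1990, Ch. V §1 (1.12), p. 164] -/
theorem narrowDefect_le_iff_signatureDefect_le (K : Type) [Field K] [NumberField K] (D : ℕ) :
    padicValNat 2 (narrowClassNumber K) ≤ padicValNat 2 (classNumber K) + D ↔
      nrRealPlaces K ≤ padicValNat 2 (Nat.card ((unitsRange K).map (signHom K))) + D := by
  have h := padicValNat_two_narrowClassNumber_add_eq K
  omega

/-- ★ **THE SIGNED OBJECT of a `ℤ₂`-tower: bounded narrow `2`-defect ⟺ bounded unit-signature defect.**  For the layers `K_n` of ANY `ℤ₂`-extension `κ`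
of a number field `K` (for any `NumberField` instance on the layer): «`∃ D, ∀ n, ord₂ h⁺(K_n) ≤ ord₂ h(K_n) + D`» ⟺ «`∃ D, ∀ n, r₁(K_n) ≤ ord₂ #sign(E_{K_n}) + D`»
— the units of `K_n` take all but at most `2^D`-index-many of the `2^{r₁(K_n)}` sign patterns.  For the cyclotomic tower of a totally real cubic `F`
(`r₁(F_n) = 3·2ⁿ`) this is Kida's narrow hypothesis `μ₂*(F) = μ₂(F)` read on units. [cite: FrohlichTaylor1990, Ch. V §1 (1.12), p. 164]
[cite: Kida1982JFields, Thm. 1 and Remark (ii)] -/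
theorem exists_narrowDefect_le_iff_exists_signatureDefect_le {K : Type} [Field K] [NumberField K] (κ : ZpExtension K 2) :
    (∃ D : ℕ, ∀ n : ℕ, ∀ [NumberField ↥(κ.layer n)],
        padicValNat 2 (narrowClassNumber ↥(κ.layer n)) ≤ padicValNat 2 (classNumber ↥(κ.layer n)) + D) ↔
      ∃ D : ℕ, ∀ n : ℕ, ∀ [NumberField ↥(κ.layer n)],
        nrRealPlaces ↥(κ.layer n) ≤ padicValNat 2 (Nat.card ((unitsRange ↥(κ.layer n)).map (signHom ↥(κ.layer n)))) + D := by
  constructor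
  · rintro ⟨D, hD⟩
    exact ⟨D, fun n _ ↦ (narrowDefect_le_iff_signatureDefect_le _ D).mp (hD n)⟩
  · rintro ⟨D, hD⟩
    exact ⟨D, fun n _ ↦ (narrowDefect_le_iff_signatureDefect_le _ D).mpr (hD n)⟩

/-- **The `∀ κ` (cyclotomic) form used by the cell's named input**: «`∃ D, ∀` cyclotomic `κ`, `∀ n`, `ord₂ h⁺(K_n) ≤ ord₂ h(K_n) + D`» ⟺ «`∃ D, ∀` cyclotomic
`κ`, `∀ n`, `r₁(K_n) ≤ ord₂ #sign(E_{K_n}) + D`». [cite: FrohlichTaylor1990, Ch. V §1 (1.12), p. 164] [cite: Kida1982JFields, Remark (ii)] -/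
theorem forall_exists_narrowDefect_le_iff_signatureDefect_le (K : Type) [Field K] [NumberField K] :
    (∃ D : ℕ, ∀ κ : ZpExtension K 2, κ.IsCyclotomic → ∀ n : ℕ, ∀ [NumberField ↥(κ.layer n)],
        padicValNat 2 (narrowClassNumber ↥(κ.layer n)) ≤ padicValNat 2 (classNumber ↥(κ.layer n)) + D) ↔
      ∃ D : ℕ, ∀ κ : ZpExtension K 2, κ.IsCyclotomic → ∀ n : ℕ, ∀ [NumberField ↥(κ.layer n)],
        nrRealPlaces ↥(κ.layer n) ≤ padicValNat 2 (Nat.card ((unitsRange ↥(κ.layer n)).map (signHom ↥(κ.layer n)))) + D := by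
  constructor
  · rintro ⟨D, hD⟩
    exact ⟨D, fun κ hκ n _ ↦ (narrowDefect_le_iff_signatureDefect_le _ D).mp (hD κ hκ n)⟩
  · rintro ⟨D, hD⟩
    exact ⟨D, fun κ hκ n _ ↦ (narrowDefect_le_iff_signatureDefect_le _ D).mpr (hD κ hκ n)⟩

end Literature.NumberTheory.IwasawaTheory

end
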